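import Mathlib
import Summits.NavierStokesRegularity.NavierStokesRegularity.Theorems.DssFarFieldSlavingBlowupTypeIDssProfileGaussianSmallTypeIIdentities
import Summits.NavierStokesRegularity.NavierStokesRegularity.Theorems.DssFarFieldSlavingBlowupTypeIDssProfileSimilarityEnstrophyHardyCore
import Literature.Analysis.FluidPDE.TaoEnstrophyLocalisationProofs
import Literature.Analysis.FluidPDE.EnstrophySplitting
import HarnessLib

/-!
# Gaussian enstrophy under a small Type-I constant, file 2/4: expansion of the pairing and the
  Cauchy–Schwarz bounds for its terms (pub-ns-dss T38/T31 scope Row 3 = «T31-G»; route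
  `DssFarFieldSlaving`, crux `BlowupTypeIDssProfile`, stmt-NavierStokesRegularity-0155 — SUPPORT,
  label-free; typer seat g7, 2026-08-23; lead A215)

HONEST FRAMING. Label-free analysis helper for BOUNDED smooth fields `Ω, U` on `ℝ³` against
`K = heatKernel 1` (a HYPOTHETICAL similarity vorticity / velocity): bookkeeping only — the expansion
of the Gaussian pairing `∫K·2⟪Ω, ΔΩ − Ω − ½DΩ[y] − DΩ[U] + DU[Ω]⟫` into four integrals, the bound
`∫K‖DΩ‖²_op ≤ Σᵢ∫K‖DΩᵢ‖²`, and the five elementary bounds of the `U`-terms by `M = sup‖U‖` and the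
Gaussian moments via the weighted Cauchy–Schwarz inequality of file 1. No census word is set here;
nothing numeric; nothing here bears on Navier–Stokes regularity or blow-up. [this file; typer T31-G]
-/

noncomputable section

set_option linter.dupNamespace false

namespace Summit.NavierStokesRegularity.NavierStokesRegularity.Theorems.GaussianGap

open Set Function Filter MeasureTheory InnerProductSpace Real Metric
open scoped RealInnerProductSpace Laplacian ContDiff Topology BigOperators
open Literature.Analysis Literature.Analysis.FluidPDE Literature.Analysis.UnboundedOperators
open Summit.NavierStokesRegularity.NavierStokesRegularity.Theorems
open Summit.NavierStokesRegularity.NavierStokesRegularity.Theorems.SimilarityEnstrophy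

section Bounds

variable {Ω U : EuclideanSpace ℝ (Fin 3) → EuclideanSpace ℝ (Fin 3)} {K₀ M : ℝ}

/-- **Expansion of the Gaussian pairing** (bookkeeping, as inside `gaussianEnstrophy_pairing_le`):
`∫K·2⟪Ω, ΔΩ − Ω − ½DΩ[y] − DΩ[U] + DU[Ω]⟫ = 2∫K⟪ΔΩ − ½DΩ[y], Ω⟫ − 2∫K|Ω|² − 2∫K⟪DΩ[U], Ω⟫
+ 2∫K⟪DU[Ω], Ω⟫` for bounded `C²`/`C¹` fields. [folklore] -/
theorem gaussianEnstrophy_pairing_expand (hΩ : ContDiff ℝ 2 Ω) (hU : ContDiff ℝ 1 U)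
    (h0 : ∀ y, ‖Ω y‖ ≤ K₀) (h1 : ∀ y, ‖fderiv ℝ Ω y‖ ≤ K₀) (h2 : ∀ y, ‖iteratedFDeriv ℝ 2 Ω y‖ ≤ K₀)
    (h3 : ∀ y, ‖U y‖ ≤ K₀) (h4 : ∀ y, ‖fderiv ℝ U y‖ ≤ K₀) :
    ∫ y, heatKernel 1 y * (2 * ⟪Ω y,
        (Δ Ω) y - Ω y - (1 / 2 : ℝ) • fderiv ℝ Ω y y - fderiv ℝ Ω y (U y) + fderiv ℝ U y (Ω y)⟫) =
      2 * (∫ y, heatKernel 1 y * ⟪(Δ Ω) y - (1 / 2 : ℝ) • fderiv ℝ Ω y y, Ω y⟫)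
        - 2 * (∫ y, heatKernel 1 y * ‖Ω y‖ ^ 2)
        - 2 * (∫ y, heatKernel 1 y * ⟪fderiv ℝ Ω y (U y), Ω y⟫)
        + 2 * (∫ y, heatKernel 1 y * ⟪fderiv ℝ U y (Ω y), Ω y⟫) := by
  have hK0 : 0 ≤ K₀ := (norm_nonneg _).trans (h0 0)
  have cK : Continuous (heatKernel (E := EuclideanSpace ℝ (Fin 3)) 1) := continuous_heatKernel 1
  have cΩ : Continuous Ω := hΩ.continuous
  have cU : Continuous U := hU.continuous
  have cDΩ : Continuous (fderiv ℝ Ω) := hΩ.continuous_fderiv (by norm_num)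
  have cDU : Continuous (fderiv ℝ U) := hU.continuous_fderiv one_ne_zero
  have cΔ : Continuous (Δ Ω) := continuous_laplacian hΩ
  have c5 : Continuous fun y => fderiv ℝ Ω y y := cDΩ.clm_apply continuous_id
  have c6 : Continuous fun y => fderiv ℝ Ω y (U y) := cDΩ.clm_apply cU
  have c7 : Continuous fun y => fderiv ℝ U y (Ω y) := cDU.clm_apply cΩ
  have c8 : Continuous fun y => (1 / 2 : ℝ) • fderiv ℝ Ω y y := c5.const_smul (1 / 2 : ℝ)
  have iZ : Integrable fun y => heatKernel 1 y * ‖Ω y‖ ^ 2 :=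
    integrable_of_le_poly_heatKernel (cK.mul (cΩ.norm.pow 2)) (C := K₀ ^ 2) (N := 0) fun y => by
      rw [Real.norm_eq_abs, abs_mul, abs_of_pos (heatKernel_one_pos y), abs_of_nonneg (by positivity),
        pow_zero, mul_one, mul_comm]
      exact mul_le_mul_of_nonneg_right (pow_le_pow_left₀ (norm_nonneg _) (h0 y) 2)
        (heatKernel_one_pos y).le
  have iOU : Integrable fun y => heatKernel 1 y * ⟪(Δ Ω) y - (1 / 2 : ℝ) • fderiv ℝ Ω y y, Ω y⟫ := by
    refine integrable_of_le_poly_heatKernel (cK.mul ((cΔ.sub c8).inner cΩ)) (C := (3 * K₀ + K₀ / 2) * K₀)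
      (N := 1) fun y => ?_
    rw [Real.norm_eq_abs, abs_mul, abs_of_pos (heatKernel_one_pos y)]
    have eΔ : ‖(Δ Ω) y‖ ≤ 3 * K₀ :=
      (norm_laplacian_le_three_mul_norm_iteratedFDeriv_two hΩ y).trans
        (mul_le_mul_of_nonneg_left (h2 y) (by norm_num))
    have e2 : ‖(1 / 2 : ℝ) • fderiv ℝ Ω y y‖ ≤ K₀ / 2 * ‖y‖ := by
      rw [norm_smul, Real.norm_of_nonneg (by norm_num : (0:ℝ) ≤ 1 / 2)]
      have := (ContinuousLinearMap.le_opNorm (fderiv ℝ Ω y) y).trans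
        (mul_le_mul_of_nonneg_right (h1 y) (norm_nonneg y))
      nlinarith
    set a : EuclideanSpace ℝ (Fin 3) := (Δ Ω) y with ha
    set c : EuclideanSpace ℝ (Fin 3) := fderiv ℝ Ω y y with hc
    set b : EuclideanSpace ℝ (Fin 3) := Ω y with hb
    have e5 : ‖a - (1 / 2 : ℝ) • c‖ ≤ (3 * K₀ + K₀ / 2) * (1 + ‖y‖) := by
      refine (norm_sub_le _ _).trans ?_
      nlinarith [norm_nonneg y, eΔ, e2, hK0]
    have hin : |⟪a - (1 / 2 : ℝ) • c, b⟫| ≤ ‖a - (1 / 2 : ℝ) • c‖ * ‖b‖ := abs_real_inner_le_norm _ _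
    have hb' : ‖b‖ ≤ K₀ := h0 y
    have hKy := (heatKernel_one_pos y).le
    have hX : 0 ≤ (3 * K₀ + K₀ / 2) * (1 + ‖y‖) := by positivity
    calc heatKernel 1 y * |⟪a - (1 / 2 : ℝ) • c, b⟫|
        ≤ heatKernel 1 y * ((3 * K₀ + K₀ / 2) * (1 + ‖y‖) * K₀) :=
          mul_le_mul_of_nonneg_left (hin.trans (mul_le_mul e5 hb' (norm_nonneg _) hX)) hKy
      _ = (3 * K₀ + K₀ / 2) * K₀ * (1 + ‖y‖) ^ 1 * heatKernel 1 y := by ring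
  have iTR : Integrable fun y => heatKernel 1 y * ⟪fderiv ℝ Ω y (U y), Ω y⟫ := by
    refine integrable_of_le_poly_heatKernel (cK.mul (c6.inner cΩ)) (C := K₀ * K₀ * K₀) (N := 0)
      fun y => ?_
    rw [Real.norm_eq_abs, abs_mul, abs_of_pos (heatKernel_one_pos y), pow_zero, mul_one]
    set d : EuclideanSpace ℝ (Fin 3) := fderiv ℝ Ω y (U y) with hd
    set b : EuclideanSpace ℝ (Fin 3) := Ω y with hb
    have e3 : ‖d‖ ≤ K₀ * K₀ :=
      (ContinuousLinearMap.le_opNorm (fderiv ℝ Ω y) (U y)).trans (mul_le_mul (h1 y) (h3 y) (norm_nonneg _) hK0)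
    have hin : |⟪d, b⟫| ≤ ‖d‖ * ‖b‖ := abs_real_inner_le_norm d b
    have hb' : ‖b‖ ≤ K₀ := h0 y
    calc heatKernel 1 y * |⟪d, b⟫| ≤ heatKernel 1 y * (K₀ * K₀ * K₀) :=
          mul_le_mul_of_nonneg_left (hin.trans (mul_le_mul e3 hb' (norm_nonneg _) (by positivity)))
            (heatKernel_one_pos y).le
      _ = K₀ * K₀ * K₀ * heatKernel 1 y := by ring
  have iST : Integrable fun y => heatKernel 1 y * ⟪fderiv ℝ U y (Ω y), Ω y⟫ := by
    refine integrable_of_le_poly_heatKernel (cK.mul (c7.inner cΩ)) (C := K₀ * K₀ * K₀) (N := 0)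
      fun y => ?_
    rw [Real.norm_eq_abs, abs_mul, abs_of_pos (heatKernel_one_pos y), pow_zero, mul_one]
    set e : EuclideanSpace ℝ (Fin 3) := fderiv ℝ U y (Ω y) with he
    set b : EuclideanSpace ℝ (Fin 3) := Ω y with hb
    have e4 : ‖e‖ ≤ K₀ * K₀ :=
      (ContinuousLinearMap.le_opNorm (fderiv ℝ U y) (Ω y)).trans (mul_le_mul (h4 y) (h0 y) (norm_nonneg _) hK0)
    have hin : |⟪e, b⟫| ≤ ‖e‖ * ‖b‖ := abs_real_inner_le_norm e b
    have hb' : ‖b‖ ≤ K₀ := h0 y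
    calc heatKernel 1 y * |⟪e, b⟫| ≤ heatKernel 1 y * (K₀ * K₀ * K₀) :=
          mul_le_mul_of_nonneg_left (hin.trans (mul_le_mul e4 hb' (norm_nonneg _) (by positivity)))
            (heatKernel_one_pos y).le
      _ = K₀ * K₀ * K₀ * heatKernel 1 y := by ring
  have e : (fun y => heatKernel 1 y * (2 * ⟪Ω y,
      (Δ Ω) y - Ω y - (1 / 2 : ℝ) • fderiv ℝ Ω y y - fderiv ℝ Ω y (U y) + fderiv ℝ U y (Ω y)⟫)) =
      fun y => 2 * (heatKernel 1 y * ⟪(Δ Ω) y - (1 / 2 : ℝ) • fderiv ℝ Ω y y, Ω y⟫)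
        - 2 * (heatKernel 1 y * ‖Ω y‖ ^ 2) - 2 * (heatKernel 1 y * ⟪fderiv ℝ Ω y (U y), Ω y⟫)
        + 2 * (heatKernel 1 y * ⟪fderiv ℝ U y (Ω y), Ω y⟫) := by
    funext y
    rw [inner_add_right, inner_sub_right, inner_sub_right, inner_sub_right, real_inner_self_eq_norm_sq,
      inner_sub_left, real_inner_smul_right, real_inner_smul_left]
    simp only [real_inner_comm (Ω y)]
    ring
  have j1 : Integrable fun y => 2 * (heatKernel 1 y * ⟪(Δ Ω) y - (1 / 2 : ℝ) • fderiv ℝ Ω y y, Ω y⟫) :=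
    iOU.const_mul 2
  have j2 : Integrable fun y => 2 * (heatKernel 1 y * ‖Ω y‖ ^ 2) := iZ.const_mul 2
  have j3 : Integrable fun y => 2 * (heatKernel 1 y * ⟪fderiv ℝ Ω y (U y), Ω y⟫) := iTR.const_mul 2
  have j4 : Integrable fun y => 2 * (heatKernel 1 y * ⟪fderiv ℝ U y (Ω y), Ω y⟫) := iST.const_mul 2
  have j12 : Integrable fun y => 2 * (heatKernel 1 y * ⟪(Δ Ω) y - (1 / 2 : ℝ) • fderiv ℝ Ω y y, Ω y⟫)
      - 2 * (heatKernel 1 y * ‖Ω y‖ ^ 2) := j1.sub j2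
  have j123 : Integrable fun y => 2 * (heatKernel 1 y * ⟪(Δ Ω) y - (1 / 2 : ℝ) • fderiv ℝ Ω y y, Ω y⟫)
      - 2 * (heatKernel 1 y * ‖Ω y‖ ^ 2) - 2 * (heatKernel 1 y * ⟪fderiv ℝ Ω y (U y), Ω y⟫) := j12.sub j3
  rw [e, integral_add j123 j4, integral_sub j12 j3, integral_sub j1 j2, integral_const_mul,
    integral_const_mul, integral_const_mul, integral_const_mul]

/-- `∫K‖DΩ‖²_op ≤ Σᵢ ∫K‖DΩᵢ‖²` (operator norm ≤ Frobenius norm, pointwise). [folklore] -/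
theorem integral_heatKernel_norm_fderiv_sq_le_sum (hΩ : ContDiff ℝ 1 Ω)
    (h1 : ∀ y, ‖fderiv ℝ Ω y‖ ≤ K₀) :
    ∫ y, heatKernel 1 y * ‖fderiv ℝ Ω y‖ ^ 2 ≤
      ∑ i, ∫ y, heatKernel 1 y * ‖fderiv ℝ (fun z => Ω z i) y‖ ^ 2 := by
  have cK : Continuous (heatKernel (E := EuclideanSpace ℝ (Fin 3)) 1) := continuous_heatKernel 1
  have hΩd : Differentiable ℝ Ω := hΩ.differentiable one_ne_zero
  have cDΩ : Continuous (fderiv ℝ Ω) := hΩ.continuous_fderiv one_ne_zero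
  have iDi : ∀ i : Fin 3, Integrable fun y => heatKernel 1 y * ‖fderiv ℝ (fun z => Ω z i) y‖ ^ 2 := by
    intro i
    have hci : ContDiff ℝ 1 (fun z => Ω z i) := contDiff_euclidean.1 hΩ i
    refine integrable_of_le_poly_heatKernel (cK.mul ((hci.continuous_fderiv one_ne_zero).norm.pow 2))
      (C := K₀ ^ 2) (N := 0) fun y => ?_
    rw [Real.norm_eq_abs, abs_mul, abs_of_pos (heatKernel_one_pos y), abs_of_nonneg (by positivity),
      pow_zero, mul_one, mul_comm]
    exact mul_le_mul_of_nonneg_right (pow_le_pow_left₀ (norm_nonneg _)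
      ((norm_fderiv_coord_le (hΩd y) i).trans (h1 y)) 2) (heatKernel_one_pos y).le
  rw [← integral_finsetSum _ fun i _ => iDi i]
  refine integral_mono ?_ (integrable_finsetSum _ fun i _ => iDi i) fun y => ?_
  · exact integrable_of_le_poly_heatKernel (cK.mul (cDΩ.norm.pow 2)) (C := K₀ ^ 2) (N := 0)
      fun y => by
        rw [Real.norm_eq_abs, abs_mul, abs_of_pos (heatKernel_one_pos y),
          abs_of_nonneg (by positivity), pow_zero, mul_one, mul_comm]
        exact mul_le_mul_of_nonneg_right (pow_le_pow_left₀ (norm_nonneg _) (h1 y) 2)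
          (heatKernel_one_pos y).le
  · have hf := (sq_opNorm_le_frobeniusNormSq (fderiv ℝ Ω y)).trans_eq
      (frobeniusNormSq_fderiv_eq_sum_norm_fderiv_coord_sq (hΩd y))
    show heatKernel 1 y * ‖fderiv ℝ Ω y‖ ^ 2 ≤ ∑ i, heatKernel 1 y * ‖fderiv ℝ (fun z => Ω z i) y‖ ^ 2
    rw [← Finset.mul_sum]
    exact mul_le_mul_of_nonneg_left hf (heatKernel_one_pos y).le

/-- **The stretching remainder:** `−∫K⟪U, DΩ[Ω]⟫ ≤ M √(∫K‖DΩ‖²) √(∫K|Ω|²)` for `‖U‖ ≤ M`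
(pointwise `|⟪U, DΩ[Ω]⟫| ≤ M‖DΩ‖‖Ω‖`, weighted Cauchy–Schwarz). [folklore] -/
theorem neg_integral_heatKernel_inner_fderiv_apply_le (hΩ : ContDiff ℝ 1 Ω) (hU : ContDiff ℝ 1 U)
    (h0 : ∀ y, ‖Ω y‖ ≤ K₀) (h1 : ∀ y, ‖fderiv ℝ Ω y‖ ≤ K₀) (h3 : ∀ y, ‖U y‖ ≤ K₀)
    (hM0 : 0 ≤ M) (hUM : ∀ y, ‖U y‖ ≤ M) :
    -(∫ y, heatKernel 1 y * ⟪U y, fderiv ℝ Ω y (Ω y)⟫) ≤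
      M * (Real.sqrt (∫ y, heatKernel 1 y * ‖fderiv ℝ Ω y‖ ^ 2) *
        Real.sqrt (∫ y, heatKernel 1 y * ‖Ω y‖ ^ 2)) := by
  have hK0 : 0 ≤ K₀ := (norm_nonneg _).trans (h0 0)
  have cK : Continuous (heatKernel (E := EuclideanSpace ℝ (Fin 3)) 1) := continuous_heatKernel 1
  have cΩ : Continuous Ω := hΩ.continuous
  have cU : Continuous U := hU.continuous
  have cDΩ : Continuous (fderiv ℝ Ω) := hΩ.continuous_fderiv one_ne_zero
  have hcs := integral_heatKernel_mul_le_sqrt_mul_sqrt (a := fun y => ‖fderiv ℝ Ω y‖)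
    (b := fun y => ‖Ω y‖) cDΩ.norm cΩ.norm (Ca := K₀) (Cb := K₀) (Na := 0) (Nb := 0)
    (fun y => by rw [abs_of_nonneg (norm_nonneg _), pow_zero, mul_one]; exact h1 y)
    (fun y => by rw [abs_of_nonneg (norm_nonneg _), pow_zero, mul_one]; exact h0 y)
  have iT : Integrable fun y => heatKernel 1 y * ⟪U y, fderiv ℝ Ω y (Ω y)⟫ := by
    refine integrable_of_le_poly_heatKernel (cK.mul (cU.inner (cDΩ.clm_apply cΩ)))
      (C := K₀ * (K₀ * K₀)) (N := 0) fun y => ?_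
    rw [Real.norm_eq_abs, abs_mul, abs_of_pos (heatKernel_one_pos y), pow_zero, mul_one]
    have e1 : |⟪U y, fderiv ℝ Ω y (Ω y)⟫| ≤ K₀ * (K₀ * K₀) :=
      (abs_real_inner_le_norm _ _).trans (mul_le_mul (h3 y) ((ContinuousLinearMap.le_opNorm _ _).trans
        (mul_le_mul (h1 y) (h0 y) (norm_nonneg _) hK0)) (norm_nonneg _) hK0)
    calc heatKernel 1 y * |⟪U y, fderiv ℝ Ω y (Ω y)⟫| ≤ heatKernel 1 y * (K₀ * (K₀ * K₀)) :=
          mul_le_mul_of_nonneg_left e1 (heatKernel_one_pos y).le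
      _ = K₀ * (K₀ * K₀) * heatKernel 1 y := by ring
  have iab : Integrable fun y => heatKernel 1 y * (‖fderiv ℝ Ω y‖ * ‖Ω y‖) := by
    refine integrable_of_le_poly_heatKernel (cK.mul (cDΩ.norm.mul cΩ.norm)) (C := K₀ * K₀) (N := 0)
      fun y => ?_
    rw [Real.norm_eq_abs, abs_mul, abs_of_pos (heatKernel_one_pos y), abs_of_nonneg (by positivity),
      pow_zero, mul_one, mul_comm]
    exact mul_le_mul_of_nonneg_right (mul_le_mul (h1 y) (h0 y) (norm_nonneg _) hK0)
      (heatKernel_one_pos y).le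
  have hpt : -(∫ y, heatKernel 1 y * ⟪U y, fderiv ℝ Ω y (Ω y)⟫) ≤
      M * ∫ y, heatKernel 1 y * (‖fderiv ℝ Ω y‖ * ‖Ω y‖) := by
    rw [← integral_neg, ← integral_const_mul]
    refine integral_mono iT.neg (iab.const_mul M) fun y => ?_
    show -(heatKernel 1 y * ⟪U y, fderiv ℝ Ω y (Ω y)⟫) ≤ M * (heatKernel 1 y * (‖fderiv ℝ Ω y‖ * ‖Ω y‖))
    have e1 : -⟪U y, fderiv ℝ Ω y (Ω y)⟫ ≤ M * (‖fderiv ℝ Ω y‖ * ‖Ω y‖) := by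
      calc -⟪U y, fderiv ℝ Ω y (Ω y)⟫ ≤ |⟪U y, fderiv ℝ Ω y (Ω y)⟫| := neg_le_abs _
        _ ≤ ‖U y‖ * ‖fderiv ℝ Ω y (Ω y)‖ := abs_real_inner_le_norm _ _
        _ ≤ M * (‖fderiv ℝ Ω y‖ * ‖Ω y‖) :=
            mul_le_mul (hUM y) (ContinuousLinearMap.le_opNorm _ _) (norm_nonneg _) hM0
    have hK := (heatKernel_one_pos y).le
    nlinarith [mul_le_mul_of_nonneg_left e1 hK]
  exact hpt.trans (mul_le_mul_of_nonneg_left hcs hM0)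

/-- **The first Gaussian moment:** `∫K|y||Ω|² ≤ √(∫K|y|²|Ω|²) √(∫K|Ω|²)`. [folklore] -/
theorem integral_heatKernel_norm_mul_norm_sq_le (hΩ : ContDiff ℝ 1 Ω) (h0 : ∀ y, ‖Ω y‖ ≤ K₀) :
    ∫ y, heatKernel 1 y * (‖y‖ * ‖Ω y‖ * ‖Ω y‖) ≤
      Real.sqrt (∫ y, heatKernel 1 y * (‖y‖ ^ 2 * ‖Ω y‖ ^ 2)) *
        Real.sqrt (∫ y, heatKernel 1 y * ‖Ω y‖ ^ 2) := by
  have cΩ : Continuous Ω := hΩ.continuous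
  have hcs := integral_heatKernel_mul_le_sqrt_mul_sqrt (a := fun y => ‖y‖ * ‖Ω y‖)
    (b := fun y => ‖Ω y‖) (continuous_norm.mul cΩ.norm) cΩ.norm (Ca := K₀) (Cb := K₀) (Na := 1)
    (Nb := 0)
    (fun y => by
      rw [abs_of_nonneg (by positivity), pow_one, mul_comm K₀]
      exact mul_le_mul (by linarith [norm_nonneg y]) (h0 y) (norm_nonneg _) (by linarith [norm_nonneg y]))
    (fun y => by rw [abs_of_nonneg (norm_nonneg _), pow_zero, mul_one]; exact h0 y)
  have e1 : (∫ y, heatKernel 1 y * (‖y‖ * ‖Ω y‖) ^ 2) = ∫ y, heatKernel 1 y * (‖y‖ ^ 2 * ‖Ω y‖ ^ 2) := by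
    refine integral_congr_ae (Eventually.of_forall fun y => ?_); simp only; ring
  rw [e1] at hcs
  exact hcs

/-- **The moment-identity remainder:** `∫K⟪DΩ[y], Ω⟫ ≤ √(∫K‖DΩ‖²) √(∫K|y|²|Ω|²)`. [folklore] -/
theorem integral_heatKernel_inner_fderiv_apply_self_le (hΩ : ContDiff ℝ 1 Ω)
    (h0 : ∀ y, ‖Ω y‖ ≤ K₀) (h1 : ∀ y, ‖fderiv ℝ Ω y‖ ≤ K₀) :
    ∫ y, heatKernel 1 y * ⟪fderiv ℝ Ω y y, Ω y⟫ ≤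
      Real.sqrt (∫ y, heatKernel 1 y * ‖fderiv ℝ Ω y‖ ^ 2) *
        Real.sqrt (∫ y, heatKernel 1 y * (‖y‖ ^ 2 * ‖Ω y‖ ^ 2)) := by
  have hK0 : 0 ≤ K₀ := (norm_nonneg _).trans (h0 0)
  have cK : Continuous (heatKernel (E := EuclideanSpace ℝ (Fin 3)) 1) := continuous_heatKernel 1
  have cΩ : Continuous Ω := hΩ.continuous
  have cDΩ : Continuous (fderiv ℝ Ω) := hΩ.continuous_fderiv one_ne_zero
  have hcs := integral_heatKernel_mul_le_sqrt_mul_sqrt (a := fun y => ‖fderiv ℝ Ω y‖)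
    (b := fun y => ‖y‖ * ‖Ω y‖) cDΩ.norm (continuous_norm.mul cΩ.norm) (Ca := K₀) (Cb := K₀)
    (Na := 0) (Nb := 1)
    (fun y => by rw [abs_of_nonneg (norm_nonneg _), pow_zero, mul_one]; exact h1 y)
    (fun y => by
      rw [abs_of_nonneg (by positivity), pow_one, mul_comm K₀]
      exact mul_le_mul (by linarith [norm_nonneg y]) (h0 y) (norm_nonneg _) (by linarith [norm_nonneg y]))
  have iD : Integrable fun y => heatKernel 1 y * ⟪fderiv ℝ Ω y y, Ω y⟫ := by
    refine integrable_of_le_poly_heatKernel (cK.mul ((cDΩ.clm_apply continuous_id).inner cΩ))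
      (C := K₀ * K₀) (N := 1) fun y => ?_
    rw [Real.norm_eq_abs, abs_mul, abs_of_pos (heatKernel_one_pos y)]
    have e1 : |⟪fderiv ℝ Ω y y, Ω y⟫| ≤ K₀ * (1 + ‖y‖) ^ 1 * K₀ := by
      refine (abs_real_inner_le_norm _ _).trans (mul_le_mul ?_ (h0 y) (norm_nonneg _) (by positivity))
      calc ‖fderiv ℝ Ω y y‖ ≤ ‖fderiv ℝ Ω y‖ * ‖y‖ := ContinuousLinearMap.le_opNorm _ _
        _ ≤ K₀ * (1 + ‖y‖) ^ 1 :=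
            mul_le_mul (h1 y) (by rw [pow_one]; linarith [norm_nonneg y]) (norm_nonneg _) hK0
    calc heatKernel 1 y * |⟪fderiv ℝ Ω y y, Ω y⟫| ≤ heatKernel 1 y * (K₀ * (1 + ‖y‖) ^ 1 * K₀) :=
          mul_le_mul_of_nonneg_left e1 (heatKernel_one_pos y).le
      _ = K₀ * K₀ * (1 + ‖y‖) ^ 1 * heatKernel 1 y := by ring
  have iab : Integrable fun y => heatKernel 1 y * (‖fderiv ℝ Ω y‖ * (‖y‖ * ‖Ω y‖)) := by
    refine integrable_of_le_poly_heatKernel (cK.mul (cDΩ.norm.mul (continuous_norm.mul cΩ.norm)))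
      (C := K₀ * K₀) (N := 1) fun y => ?_
    rw [Real.norm_eq_abs, abs_mul, abs_of_pos (heatKernel_one_pos y), abs_of_nonneg (by positivity)]
    have e1 : ‖fderiv ℝ Ω y‖ * (‖y‖ * ‖Ω y‖) ≤ K₀ * ((1 + ‖y‖) ^ 1 * K₀) :=
      mul_le_mul (h1 y) (mul_le_mul (by rw [pow_one]; linarith [norm_nonneg y]) (h0 y)
        (norm_nonneg _) (by positivity)) (by positivity) hK0
    calc heatKernel 1 y * (‖fderiv ℝ Ω y‖ * (‖y‖ * ‖Ω y‖)) ≤ heatKernel 1 y * (K₀ * ((1 + ‖y‖) ^ 1 * K₀)) :=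
          mul_le_mul_of_nonneg_left e1 (heatKernel_one_pos y).le
      _ = K₀ * K₀ * (1 + ‖y‖) ^ 1 * heatKernel 1 y := by ring
  have hpt : ∫ y, heatKernel 1 y * ⟪fderiv ℝ Ω y y, Ω y⟫ ≤
      ∫ y, heatKernel 1 y * (‖fderiv ℝ Ω y‖ * (‖y‖ * ‖Ω y‖)) := by
    refine integral_mono iD iab fun y => ?_
    have e1 : ⟪fderiv ℝ Ω y y, Ω y⟫ ≤ ‖fderiv ℝ Ω y‖ * (‖y‖ * ‖Ω y‖) := by
      calc ⟪fderiv ℝ Ω y y, Ω y⟫ ≤ |⟪fderiv ℝ Ω y y, Ω y⟫| := le_abs_self _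
        _ ≤ ‖fderiv ℝ Ω y y‖ * ‖Ω y‖ := abs_real_inner_le_norm _ _
        _ ≤ (‖fderiv ℝ Ω y‖ * ‖y‖) * ‖Ω y‖ :=
            mul_le_mul_of_nonneg_right (ContinuousLinearMap.le_opNorm _ _) (norm_nonneg _)
        _ = ‖fderiv ℝ Ω y‖ * (‖y‖ * ‖Ω y‖) := by ring
    exact mul_le_mul_of_nonneg_left e1 (heatKernel_one_pos y).le
  have e1 : (∫ y, heatKernel 1 y * (‖y‖ * ‖Ω y‖) ^ 2) = ∫ y, heatKernel 1 y * (‖y‖ ^ 2 * ‖Ω y‖ ^ 2) := by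
    refine integral_congr_ae (Eventually.of_forall fun y => ?_); simp only; ring
  rw [e1] at hcs
  exact hpt.trans hcs

/-- `K|y||Ω|² ∈ L¹(ℝ³)` for a bounded continuous field. [folklore] -/
theorem integrable_heatKernel_norm_mul_norm_mul_norm (hΩ : ContDiff ℝ 1 Ω) (h0 : ∀ y, ‖Ω y‖ ≤ K₀) :
    Integrable fun y => heatKernel 1 y * (‖y‖ * ‖Ω y‖ * ‖Ω y‖) := by
  have hK0 : 0 ≤ K₀ := (norm_nonneg _).trans (h0 0)
  have cK : Continuous (heatKernel (E := EuclideanSpace ℝ (Fin 3)) 1) := continuous_heatKernel 1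
  have cΩ : Continuous Ω := hΩ.continuous
  refine integrable_of_le_poly_heatKernel (cK.mul ((continuous_norm.mul cΩ.norm).mul cΩ.norm))
    (C := K₀ * K₀) (N := 1) fun y => ?_
  rw [Real.norm_eq_abs, abs_mul, abs_of_pos (heatKernel_one_pos y), abs_of_nonneg (by positivity)]
  have e1 : ‖y‖ * ‖Ω y‖ * ‖Ω y‖ ≤ (1 + ‖y‖) ^ 1 * K₀ * K₀ :=
    mul_le_mul (mul_le_mul (by rw [pow_one]; linarith [norm_nonneg y]) (h0 y) (norm_nonneg _)
      (by positivity)) (h0 y) (norm_nonneg _) (by positivity)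
  calc heatKernel 1 y * (‖y‖ * ‖Ω y‖ * ‖Ω y‖) ≤ heatKernel 1 y * ((1 + ‖y‖) ^ 1 * K₀ * K₀) :=
        mul_le_mul_of_nonneg_left e1 (heatKernel_one_pos y).le
    _ = K₀ * K₀ * (1 + ‖y‖) ^ 1 * heatKernel 1 y := by ring

/-- **The inward-flux term:** `−∫K⟪y,U⟫|Ω|² ≤ M ∫K|y||Ω|²` for `‖U‖ ≤ M`. [folklore] -/
theorem neg_integral_heatKernel_flux_le (hΩ : ContDiff ℝ 1 Ω) (hU : ContDiff ℝ 1 U)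
    (h0 : ∀ y, ‖Ω y‖ ≤ K₀) (h3 : ∀ y, ‖U y‖ ≤ K₀) (hUM : ∀ y, ‖U y‖ ≤ M) :
    -(∫ y, heatKernel 1 y * (⟪y, U y⟫ * ‖Ω y‖ ^ 2)) ≤
      M * ∫ y, heatKernel 1 y * (‖y‖ * ‖Ω y‖ * ‖Ω y‖) := by
  have hK0 : 0 ≤ K₀ := (norm_nonneg _).trans (h0 0)
  have cK : Continuous (heatKernel (E := EuclideanSpace ℝ (Fin 3)) 1) := continuous_heatKernel 1
  have cΩ : Continuous Ω := hΩ.continuous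
  have cU : Continuous U := hU.continuous
  have iFL : Integrable fun y => heatKernel 1 y * (⟪y, U y⟫ * ‖Ω y‖ ^ 2) := by
    refine integrable_of_le_poly_heatKernel (cK.mul ((continuous_id.inner cU).mul (cΩ.norm.pow 2)))
      (C := K₀ * K₀ ^ 2) (N := 1) fun y => ?_
    rw [Real.norm_eq_abs, abs_mul, abs_of_pos (heatKernel_one_pos y), abs_mul,
      abs_of_nonneg (by positivity : (0:ℝ) ≤ ‖Ω y‖ ^ 2)]
    have e1 : |⟪y, U y⟫| ≤ (1 + ‖y‖) * K₀ := (abs_real_inner_le_norm y (U y)).trans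
      (mul_le_mul (by linarith [norm_nonneg y]) (h3 y) (norm_nonneg _) (by linarith [norm_nonneg y]))
    have e2 : ‖Ω y‖ ^ 2 ≤ K₀ ^ 2 := pow_le_pow_left₀ (norm_nonneg _) (h0 y) 2
    calc heatKernel 1 y * (|⟪y, U y⟫| * ‖Ω y‖ ^ 2) ≤ heatKernel 1 y * ((1 + ‖y‖) * K₀ * K₀ ^ 2) :=
          mul_le_mul_of_nonneg_left (mul_le_mul e1 e2 (by positivity) (by positivity))
            (heatKernel_one_pos y).le
      _ = K₀ * K₀ ^ 2 * (1 + ‖y‖) ^ 1 * heatKernel 1 y := by ring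
  have iWd := integrable_heatKernel_norm_mul_norm_mul_norm hΩ h0
  rw [← integral_neg, ← integral_const_mul]
  refine integral_mono iFL.neg (iWd.const_mul M) fun y => ?_
  show -(heatKernel 1 y * (⟪y, U y⟫ * ‖Ω y‖ ^ 2)) ≤ M * (heatKernel 1 y * (‖y‖ * ‖Ω y‖ * ‖Ω y‖))
  have e1 : -⟪y, U y⟫ ≤ ‖y‖ * M := by
    calc -⟪y, U y⟫ ≤ |⟪y, U y⟫| := neg_le_abs _
      _ ≤ ‖y‖ * ‖U y‖ := abs_real_inner_le_norm _ _
      _ ≤ ‖y‖ * M := mul_le_mul_of_nonneg_left (hUM y) (norm_nonneg _)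
  have hK := (heatKernel_one_pos y).le
  have hΩ2 : 0 ≤ ‖Ω y‖ ^ 2 := sq_nonneg _
  nlinarith [mul_le_mul_of_nonneg_right e1 hΩ2, mul_nonneg hK hΩ2]

/-- **The cross moment term:** `∫K⟪y,Ω⟫⟪U,Ω⟫ ≤ M ∫K|y||Ω|²` for `‖U‖ ≤ M`. [folklore] -/
theorem integral_heatKernel_cross_moment_le (hΩ : ContDiff ℝ 1 Ω) (hU : ContDiff ℝ 1 U)
    (h0 : ∀ y, ‖Ω y‖ ≤ K₀) (h3 : ∀ y, ‖U y‖ ≤ K₀) (hUM : ∀ y, ‖U y‖ ≤ M) :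
    ∫ y, heatKernel 1 y * (⟪y, Ω y⟫ * ⟪U y, Ω y⟫) ≤
      M * ∫ y, heatKernel 1 y * (‖y‖ * ‖Ω y‖ * ‖Ω y‖) := by
  have hK0 : 0 ≤ K₀ := (norm_nonneg _).trans (h0 0)
  have cK : Continuous (heatKernel (E := EuclideanSpace ℝ (Fin 3)) 1) := continuous_heatKernel 1
  have cΩ : Continuous Ω := hΩ.continuous
  have cU : Continuous U := hU.continuous
  have iYO : Integrable fun y => heatKernel 1 y * (⟪y, Ω y⟫ * ⟪U y, Ω y⟫) := by
    refine integrable_of_le_poly_heatKernel (cK.mul ((continuous_id.inner cΩ).mul (cU.inner cΩ)))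
      (C := K₀ * (K₀ * K₀)) (N := 1) fun y => ?_
    rw [Real.norm_eq_abs, abs_mul, abs_of_pos (heatKernel_one_pos y), abs_mul]
    have e1 : |⟪y, Ω y⟫| ≤ (1 + ‖y‖) * K₀ := (abs_real_inner_le_norm _ _).trans
      (mul_le_mul (by linarith [norm_nonneg y]) (h0 y) (norm_nonneg _) (by linarith [norm_nonneg y]))
    have e2 : |⟪U y, Ω y⟫| ≤ K₀ * K₀ :=
      (abs_real_inner_le_norm _ _).trans (mul_le_mul (h3 y) (h0 y) (norm_nonneg _) hK0)
    calc heatKernel 1 y * (|⟪y, Ω y⟫| * |⟪U y, Ω y⟫|)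
        ≤ heatKernel 1 y * (((1 + ‖y‖) * K₀) * (K₀ * K₀)) :=
          mul_le_mul_of_nonneg_left (mul_le_mul e1 e2 (abs_nonneg _) (by positivity))
            (heatKernel_one_pos y).le
      _ = K₀ * (K₀ * K₀) * (1 + ‖y‖) ^ 1 * heatKernel 1 y := by ring
  have iWd := integrable_heatKernel_norm_mul_norm_mul_norm hΩ h0
  rw [← integral_const_mul]
  refine integral_mono iYO (iWd.const_mul M) fun y => ?_
  show heatKernel 1 y * (⟪y, Ω y⟫ * ⟪U y, Ω y⟫) ≤ M * (heatKernel 1 y * (‖y‖ * ‖Ω y‖ * ‖Ω y‖))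
  have e1 : ⟪y, Ω y⟫ * ⟪U y, Ω y⟫ ≤ M * (‖y‖ * ‖Ω y‖ * ‖Ω y‖) := by
    calc ⟪y, Ω y⟫ * ⟪U y, Ω y⟫ ≤ |⟪y, Ω y⟫ * ⟪U y, Ω y⟫| := le_abs_self _
      _ = |⟪y, Ω y⟫| * |⟪U y, Ω y⟫| := abs_mul _ _
      _ ≤ (‖y‖ * ‖Ω y‖) * (‖U y‖ * ‖Ω y‖) :=
          mul_le_mul (abs_real_inner_le_norm _ _) (abs_real_inner_le_norm _ _) (abs_nonneg _)
            (by positivity)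
      _ ≤ (‖y‖ * ‖Ω y‖) * (M * ‖Ω y‖) :=
          mul_le_mul_of_nonneg_left (mul_le_mul_of_nonneg_right (hUM y) (norm_nonneg _))
            (by positivity)
      _ = M * (‖y‖ * ‖Ω y‖ * ‖Ω y‖) := by ring
  have hK := (heatKernel_one_pos y).le
  nlinarith [mul_le_mul_of_nonneg_left e1 hK]

end Bounds

end Summit.NavierStokesRegularity.NavierStokesRegularity.Theorems.GaussianGap
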